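import Summits.CriticalPhenomena.PercolationContinuityZ3.Theorems.Transplant.AutChartTreeSkeletonProxies
import Summits.CriticalPhenomena.PercolationContinuityZ3.Theorems.Transplant.AutCylinderNilpotent
import HarnessLib

/-!
# JOINT SUFFICIENCY OF THE QUASI-STEP NODE SPEC: the hC-node over `PlanarSkeletonFrmQuasi` (taken as a HYPOTHESIS binder, never declared) implies the
# end-state-with-cylinders hypothesis `hN` of «AutCylinderInduction» — hence Benjamini–Schramm Conj. 4 for every quasi-transitive graph of polynomial growth
# (modulo Trofimov) and for every Cayley graph of polynomial growth of every f.g. virtually nilpotent group (no named fact)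

builds on p205010 (kernel theorem, internal audit signed; external expert review pending) — nothing in this file uses p205010; NOTHING is claimed about any
node: the node statement enters ONLY as the hypothesis binder `hNode` (its name, its `@[conjecture]` form and its words are the lead's).  Lane `prim-bschramm`,
seat `prim-bschramm-p5` gen 28 (refuter / sharpness seat: the joint-sufficiency check of the design owner's NODE-FILE SPEC, lane INBOX 2026-08-27 06:58Z (5) /
07:24Z).  Helper file (`--supports stmt-CriticalPhenomena-4575 --as helper`); PROOFS ONLY (def-free).

WHAT IS CHECKED.  The spec is `hNode : ∀ G Φ t D, t ∈ Φ.types → Φ.HasProxies t D → Φ.CylSubcritical (p_c(G,t)) → θ_t(p_c) = 0` (p486426's node with the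
cylinder hypothesis kept).  **`endStateCyl_of_quasiNode hNode`** derives from it — LITERALLY — the hypothesis `hN` of `AutCyl.conj4_polynomialGrowth_of_endStateCyl`:
for every connected locally finite `G`, every `A₀ ≤ Aut(G)` with finitely many orbits and a rank-two character killing the stabilisers, IF every finite-box
cylinder of every equivariant rank-two chart is subcritical at `p_c` THEN `θ_x(p_c) = 0` everywhere.  Route: exponential growth ⇒ Hutchcroft; otherwise the
tree chart gives the carrier with proxies at every vertex (`AutChart.exists_frmQuasi_hasProxies`, p509184); its cylinders (coarse boxes) are fine boxes of
the `A₀`-equivariant fine chart (`coarseCyl_eq_fineBox`), rank two by the axis edges; `p_c` is constant on the connected `G`; so the spec's `CylSubcritical` is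
an instance of the cylinder hypothesis; the node gives `θ_t = 0` at a type and the frame of `x` transports it.  COROLLARIES (one-liners):
`conj4_polynomialGrowth_of_quasiNode (hT) (hNode) : BenjaminiSchramm1996_conj4_polynomialGrowth` and `conj4_cayley_virtuallyNilpotent_of_quasiNode` (part IV,
no named fact).  So the node spec is CERTIFIED SUFFICIENT for the C2 word before the binder wave's tops are re-instantiated.
[cite: BenjaminiSchramm1996, Conj. 4; §2 (almost transitive graphs)] [cite: KozmaNitzan2024, §4 p. 15 (boxes)] [cite: Hutchcroft2016, Thm. 1.1]
[cite: Trofimov1985, Thm. 2] [cite: GrimmettPercolation1999, Thm. (2.8) p. 35]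
-/

noncomputable section

namespace Summit.CriticalPhenomena.PercolationContinuityZ3.Theorems.Transplant

open SimpleGraph Literature.Barriers.CriticalPhenomena Literature.Probability.LatticeModels Literature.Probability.Percolation
open Literature.Combinatorics.SimpleGraph (Trofimov1985_polynomialGrowthBlocks)
open scoped Classical

namespace AutChart

/-! ## §1 Bookkeeping: induced graphs on equal sets; coarse cylinders are fine boxes -/

/-- `θ` of an induced graph depends only on the inducing SET (congruence along a set identity). [folklore] -/
theorem theta_induce_congr {W : Type} {G : SimpleGraph W} {S S' : Set W} (h : S = S') {r : W} (hr : r ∈ S) (hr' : r ∈ S') (p : unitInterval) :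
    theta (G.induce S) ⟨r, hr⟩ p = theta (G.induce S') ⟨r, hr'⟩ p := by
  subst h
  rfl

namespace TreeDatum

variable {V : Type} {G : SimpleGraph V} {A : Type} [Group A] [MulAction A V] (D : TreeDatum G A) [G.LocallyFinite]

/-- **The fine box of a coarse cylinder**: the values `y ∈ ℤ²` with `⌊y/N⌋ − coarse t ∈ box ℓ`. [cite: KozmaNitzan2024, §4 p. 15 (boxes)] -/
theorem coarseCyl_eq_fineBox (t : V) (ℓ : ℕ) :
    {w | D.coarse w - D.coarse t ∈ box 2 ℓ} =
      {w | D.chart w ∈ ((Fintype.piFinset fun j : Fin 2 =>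
        Finset.Icc ((D.N : ℤ) * (D.coarse t j - ℓ)) ((D.N : ℤ) * (D.coarse t j + ℓ + 1) - 1)) : Set (Site 2))} := by
  have hN := D.N_pos
  ext w
  simp only [Set.mem_setOf_eq, Finset.mem_coe, Fintype.mem_piFinset, Finset.mem_Icc, mem_box, Pi.sub_apply, D.coarse_apply]
  refine forall_congr' fun j => ?_
  constructor
  · rintro ⟨h1, h2⟩
    have h3 := (Int.le_ediv_iff_mul_le hN).1 (show D.chart t j / (D.N : ℤ) - ℓ ≤ D.chart w j / D.N by linarith)
    have h4 := (Int.ediv_lt_iff_lt_mul hN).1 (show D.chart w j / (D.N : ℤ) < D.chart t j / D.N + ℓ + 1 by linarith)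
    constructor <;> linarith
  · rintro ⟨h1, h2⟩
    have h3 := (Int.le_ediv_iff_mul_le hN).2 (show (D.chart t j / (D.N : ℤ) - ℓ) * D.N ≤ D.chart w j by linarith)
    have h4 := (Int.ediv_lt_iff_lt_mul hN).2 (show D.chart w j < (D.chart t j / (D.N : ℤ) + ℓ + 1) * D.N by linarith)
    constructor <;> linarith

omit [G.LocallyFinite] in
/-- **The fine chart has rank two** on `A` (the axis edges carry the values `Δ e₀`, `Δ e₁`). [folklore] -/
theorem exists_det2_ne_zero : ∃ a b : A, MaxArea.det2 (Multiplicative.toAdd (D.c a)) (Multiplicative.toAdd (D.c b)) ≠ 0 := by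
  obtain ⟨-, -, n₀, -, hn₀⟩ := D.axis 0 1
  obtain ⟨-, -, n₁, -, hn₁⟩ := D.axis 1 1
  have h0 : Multiplicative.toAdd (D.c (osec D.cover n₀)) = Pi.single 0 (D.Δ : ℤ) := by
    have e : ochart D.cover D.c n₀ = Multiplicative.toAdd (D.c (osec D.cover n₀)) := rfl
    rw [← e, hn₀, Units.val_one, mul_one]
  have h1 : Multiplicative.toAdd (D.c (osec D.cover n₁)) = Pi.single 1 (D.Δ : ℤ) := by
    have e : ochart D.cover D.c n₁ = Multiplicative.toAdd (D.c (osec D.cover n₁)) := rfl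
    rw [← e, hn₁, Units.val_one, mul_one]
  have hΔ : (0 : ℤ) < D.Δ := by exact_mod_cast (D.one_le_Δ : 0 < D.Δ)
  have e : MaxArea.det2 (Pi.single 0 (D.Δ : ℤ) : Site 2) (Pi.single 1 (D.Δ : ℤ)) = (D.Δ : ℤ) * D.Δ := by
    unfold MaxArea.det2
    simp
  refine ⟨osec D.cover n₀, osec D.cover n₁, ?_⟩
  rw [h0, h1, e]
  exact mul_ne_zero hΔ.ne' hΔ.ne'

end TreeDatum

/-! ## §2 The node spec implies the end-state-with-cylinders hypothesis -/

/-- **JOINT SUFFICIENCY**: the hC-node over `PlanarSkeletonFrmQuasi` (hypothesis `hNode`, the design owner's spec) implies the hypothesis `hN` of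
«AutCylinderInduction» — the end-state node with the cylinder hypothesis — for every connected locally finite graph.
[cite: BenjaminiSchramm1996, Conj. 4; §2] [cite: Hutchcroft2016, Thm. 1.1] [cite: KozmaNitzan2024, §4 p. 15 (boxes)] -/
theorem endStateCyl_of_quasiNode
    (hNode : ∀ {W : Type} (G : SimpleGraph W) [G.LocallyFinite] (Φ : PlanarSkeletonFrmQuasi G) (t : W) (D : ℕ),
      t ∈ Φ.types → Φ.HasProxies t D → Φ.CylSubcritical (criticalProbIOf G t) → theta G t (criticalProbIOf G t) = 0) :
    ∀ {W : Type} (G : SimpleGraph W) [G.LocallyFinite], G.Connected →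
      ∀ (A₀ : Subgroup (G ≃g G)) (reps : Finset W) (c : A₀ →* Multiplicative (Site 2)),
        (∀ w : W, ∃ a : A₀, ∃ s ∈ reps, (a : G ≃g G) s = w) → (∀ (a : A₀) (w : W), (a : G ≃g G) w = w → c a = 1) →
        (∃ a b : A₀, MaxArea.det2 (Multiplicative.toAdd (c a)) (Multiplicative.toAdd (c b)) ≠ 0) →
        (∀ (χ : W → Site 2) (τ : A₀ → Site 2), (∀ (a : A₀) (w : W), χ ((a : G ≃g G) w) = τ a + χ w) →
          (∃ a b : A₀, MaxArea.det2 (τ a) (τ b) ≠ 0) →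
          ∀ (B : Finset (Site 2)) (r : W) (hr : χ r ∈ B),
            theta (G.induce {w | χ w ∈ (B : Set (Site 2))}) ⟨r, hr⟩ (criticalProbIOf G r) = 0) →
        ∀ x : W, theta G x (criticalProbIOf G x) = 0 := by
  intro W G _ hc A₀ reps c hcover hstab hrank HC x
  haveI : Countable W := countable_of_connected_of_locallyFinite G hc x
  have hact : IsActionByAut G A₀ := fun a y z => (a : G ≃g G).map_rel_iff'
  have hcover' : ∀ w : W, ∃ a : A₀, ∃ s ∈ reps, a • s = w := fun w => by
    obtain ⟨a, s, hs, hw⟩ := hcover w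
    exact ⟨a, s, hs, hw⟩
  -- quasi-transitivity, and the exponential-growth case (Hutchcroft)
  have hq : IsQuasiTransitive G := ⟨reps, fun v => by
    obtain ⟨a, s, hs, hw⟩ := hcover v
    exact ⟨(a : G ≃g G).symm, by rw [← hw, RelIso.symm_apply_apply]; exact hs⟩⟩
  by_cases hG : HasExponentialGrowth G
  · exact Hutchcroft2016_noPercolationAtCriticality_holds G hc hq hG x
  -- off exponential growth: the tree chart's carrier with proxies at every vertex
  obtain ⟨a₀, t₀, -, -⟩ := hcover' x
  have hstab' : ∀ h ∈ MulAction.stabilizer A₀ t₀, c h = 1 := fun h hh => hstab h t₀ (MulAction.mem_stabilizer_iff.1 hh)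
  obtain ⟨D, Φ, Dp, u, w, -, hφ, hprox⟩ := exists_frmQuasi_hasProxies hact hc reps hcover' c hstab' hrank hG
  -- the frame of `x`
  obtain ⟨t, ht, α, hαt, -⟩ := Φ.frame x
  -- the cylinder hypothesis of the node at `t`, from `HC` through the fine chart
  have hC : Φ.CylSubcritical (criticalProbIOf G t) := by
    intro t' _ ℓ
    have hpc : criticalProbIOf G t' = criticalProbIOf G t := Subtype.ext (criticalProb_eq_of_reachable G (hc.preconnected t' t))
    have hcyl : Φ.cyl t' ℓ = {w | D.coarse w - D.coarse t' ∈ box 2 ℓ} := by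
      show {w | Φ.φ w - Φ.φ t' ∈ box 2 ℓ} = _
      rw [hφ]
    set B : Finset (Site 2) := Fintype.piFinset fun j : Fin 2 =>
      Finset.Icc ((D.N : ℤ) * (D.coarse t' j - ℓ)) ((D.N : ℤ) * (D.coarse t' j + ℓ + 1) - 1) with hB
    have hS : Φ.cyl t' ℓ = {w | D.chart w ∈ (B : Set (Site 2))} := hcyl.trans (D.coarseCyl_eq_fineBox t' ℓ)
    have ht'S : t' ∈ {w | D.chart w ∈ (B : Set (Site 2))} := by
      rw [← hS]
      show Φ.φ t' - Φ.φ t' ∈ box 2 ℓ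
      rw [sub_self]
      exact zero_mem_box 2 ℓ
    have hχ : ∀ (a : A₀) (w : W), D.chart ((a : G ≃g G) w) = Multiplicative.toAdd (D.c a) + D.chart w := fun a w => D.chart_smul a w
    have key := HC D.chart (fun a => Multiplicative.toAdd (D.c a)) hχ D.exists_det2_ne_zero B t' ht'S
    rw [hpc] at key
    exact (theta_induce_congr hS _ ht'S (criticalProbIOf G t)).trans key
  have hθt : theta G t (criticalProbIOf G t) = 0 := hNode G Φ t Dp ht (hprox t) hC
  -- transport to `x = α t`
  have e1 := theta_iso α t (criticalProbIOf G t)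
  have e2 : criticalProbIOf G (α t) = criticalProbIOf G t := Subtype.ext (criticalProb_iso α t)
  rw [← hαt, e2, e1]
  exact hθt

/-! ## §3 Corollaries: C2 and the virtually nilpotent Cayley graphs -/

/-- **The node spec gives Benjamini–Schramm's Conjecture 4 for EVERY quasi-transitive graph of polynomial growth** (modulo Trofimov's theorem): the hC-node +
the tree chart + the growth-degree induction. [cite: BenjaminiSchramm1996, Conj. 4] [cite: Trofimov1985, Thm. 2] -/
theorem conj4_polynomialGrowth_of_quasiNode (hT : Trofimov1985_polynomialGrowthBlocks)
    (hNode : ∀ {W : Type} (G : SimpleGraph W) [G.LocallyFinite] (Φ : PlanarSkeletonFrmQuasi G) (t : W) (D : ℕ),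
      t ∈ Φ.types → Φ.HasProxies t D → Φ.CylSubcritical (criticalProbIOf G t) → theta G t (criticalProbIOf G t) = 0) :
    BenjaminiSchramm1996_conj4_polynomialGrowth :=
  AutCyl.conj4_polynomialGrowth_of_endStateCyl hT (endStateCyl_of_quasiNode hNode)

/-- **… and for every Cayley graph of polynomial growth of every finitely generated virtually nilpotent group, with NO named fact** (part IV's free-nilpotent
induction). [cite: BenjaminiSchramm1996, Conj. 4] -/
theorem conj4_cayley_virtuallyNilpotent_of_quasiNode
    (hNode : ∀ {W : Type} (G : SimpleGraph W) [G.LocallyFinite] (Φ : PlanarSkeletonFrmQuasi G) (t : W) (D : ℕ),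
      t ∈ Φ.types → Φ.HasProxies t D → Φ.CylSubcritical (criticalProbIOf G t) → theta G t (criticalProbIOf G t) = 0)
    {Γ : Type} [Group Γ] (S : Finset Γ) (hS : Subgroup.closure (S : Set Γ) = ⊤) (N : Subgroup Γ) [N.FiniteIndex] [Group.IsNilpotent N]
    (hpoly : ∃ C D : ℝ, ∀ (g : Γ) (n : ℕ), (ballVolume (mulCayley (↑S : Set Γ)) g n : ℝ) ≤ C * ((n : ℝ) + 1) ^ D) (g : Γ)
    (hpc : criticalProb (mulCayley (↑S : Set Γ)) g < 1) :
    theta (mulCayley (↑S : Set Γ)) g (criticalProbIOf (mulCayley (↑S : Set Γ)) g) = 0 :=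
  AutCyl.conj4_cayley_virtuallyNilpotent_of_endStateCyl (endStateCyl_of_quasiNode hNode) S hS N hpoly g hpc

end AutChart

end Summit.CriticalPhenomena.PercolationContinuityZ3.Theorems.Transplant

end
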